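import Mathlib
import Literature.RingTheory.GradedAlgebra.QuotientGrading
import Summits.ResolutionOfSingularities.ResolutionOfSingularities.Theorems.WeightedInvariantDatumToEmbeddedQuotientSingularitiesGraded
import Summits.ResolutionOfSingularities.ResolutionOfSingularities.Theorems.WeightedInvariantDatumToEmbeddedQuotientSingularitiesSmoothAt
import HarnessLib

/-!
# The slice of a graded algebra at a maximal ideal: construction and grading

Topic: `Summits/ResolutionOfSingularities/ResolutionOfSingularities/Theorems`. Helper file of the
stub `stub_quotientSingularities_of_regular` of the line `Sketch` of the crux
`Theses.WeightedInvariant.DatumToEmbedded` (statement `stmt-ResolutionOfSingularities-0572`).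

Setting (the base case of the cobordant tower, one affine chart, after localising): a commutative
`k`-algebra `R = ⨁_{χ ∈ G} R_χ` graded by an abelian group `G` (a diagonalizable group action on
`Spec R` with quotient `Spec R₀`), a maximal ideal `P` (a closed point `x`, residue field
`κ = κ`), a lattice `M ≤ G` with a `ℤ`-basis `b₁, …, bₘ` and homogeneous UNITS `uₗ ∈ R_{bₗ}`
(so `M` is contained in the character lattice of every orbit). The **slice** through `x` is
`S := (κ ⊗ₖ R) ⧸ (1 ⊗ uₗ - ūₗ ⊗ 1)ₗ` (`Slice`), the fibre over the `κ`-point `(ūₗ)` of the smooth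
morphism `u : Spec R → Spec k[M] = 𝔾ₘᵐ`; it is graded by the finite group `A = G ⧸ M` (the
character group of the stabiliser): coarsen the base-changed grading of `κ ⊗ₖ R` along
`G → G ⧸ M` (`basePiece`, `coarsePiece`) and pass to the quotient by the ideal of the slice,
homogeneous of degree `0` (`isHomogeneous_sliceIdeal`, `slicePiece`;
`Literature/RingTheory/GradedAlgebra/QuotientGrading`). This file also provides the
multiplicative section `χ ↦ u^χ = ∏ uₗ ^ χₗ` of homogeneous units over `M` (`unitSection`) and the
relations `1 ⊗ u^χ ≡ ū^χ ⊗ 1` in `S` (`mk_one_tmul_unitSection`), used in the sibling file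
`…QuotientSingularitiesSliceZero` to identify the degree-`0` part `S₀` with `R₀ ⊗ₖ κ`.
[folklore: Luna's étale slice theorem for diagonalizable groups, Zariski form; cf.
Alper–Hall–Rydh, *A Luna étale slice theorem for algebraic stacks*, and Włodarczyk
arXiv:2203.03090 §2.3]

Only Mathlib, `Literature/RingTheory/GradedAlgebra/QuotientGrading` and the sibling helper files
are used.
-/

-- the summit namespace repeats `ResolutionOfSingularities` by design (mandated namespace)
set_option linter.dupNamespace false

namespace Summit.ResolutionOfSingularities.ResolutionOfSingularities.Theorems.DatumToEmbedded.QuotientSingularities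

open DirectSum TensorProduct Literature.RingTheory.GradedAlgebra

section Setting

variable {k : Type} [Field k] {R : Type} [CommRing R] [Algebra k R]
  {G : Type} [AddCommGroup G] [DecidableEq G] (𝓡 : G → Submodule k R) [GradedAlgebra 𝓡]
  {κ : Type} [CommRing κ] [Algebra k κ] (π : R →ₐ[k] κ) (M : Submodule ℤ G)

/-! ## The gradings of `κ ⊗ₖ R` -/

/-- The `G`-grading of `κ ⊗ₖ R` (`κ` a commutative `k`-algebra, later the residue field) by the
base-changed pieces `κ ⊗ₖ R_χ`, as `k`-submodules. [folklore] -/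
def basePiece (χ : G) : Submodule k (κ ⊗[k] R) :=
  ((𝓡 χ).baseChange κ).restrictScalars k

/-- The base-changed pieces form a grading. [folklore] -/
noncomputable instance basePiece.gradedAlgebra : GradedAlgebra (basePiece (κ := κ) 𝓡) :=
  Classical.choice (nonempty_gradedRing_of_mem_iff (fun χ => (𝓡 χ).baseChange κ)
    (basePiece (κ := κ) 𝓡) fun _ _ => Iff.rfl)

variable {𝓡} in
omit [AddCommGroup G] [DecidableEq G] [GradedAlgebra 𝓡] in
/-- `c ⊗ r` is homogeneous of degree `χ` for `r ∈ R_χ`. [folklore] -/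
theorem tmul_mem_basePiece [AddMonoid G] {χ : G} (c : κ) {r : R} (hr : r ∈ 𝓡 χ) :
    c ⊗ₜ[k] r ∈ basePiece 𝓡 χ :=
  Submodule.tmul_mem_baseChange_of_mem c hr

/-- The **coarse grading** of `κ ⊗ₖ R` by `A = G ⧸ M`: `(κ ⊗ₖ R)_ā = ⨁_{χ ∈ ā} κ ⊗ₖ R_χ`.
[folklore] -/
def coarsePiece : G ⧸ M → Submodule k (κ ⊗[k] R) :=
  coarsen (basePiece (κ := κ) 𝓡) M.mkQ.toAddMonoidHom

/-- The coarse pieces form a grading. [folklore] -/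
noncomputable instance coarsePiece.gradedAlgebra [DecidableEq (G ⧸ M)] :
    GradedAlgebra (coarsePiece (κ := κ) 𝓡 M) :=
  Classical.choice (nonempty_gradedAlgebra_coarsen (basePiece (κ := κ) 𝓡) M.mkQ.toAddMonoidHom)

variable {𝓡 π M} in
omit [DecidableEq G] [GradedAlgebra 𝓡] in
/-- `c ⊗ r` has coarse degree `[χ]` for `r ∈ R_χ`. [folklore] -/
theorem tmul_mem_coarsePiece [SetLike.GradedMonoid 𝓡] {χ : G} (c : κ) {r : R} (hr : r ∈ 𝓡 χ) :
    c ⊗ₜ[k] r ∈ coarsePiece 𝓡 M (Submodule.Quotient.mk χ) :=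
  le_coarsen (𝒜 := basePiece (κ := κ) 𝓡) (φ := M.mkQ.toAddMonoidHom) rfl (tmul_mem_basePiece c hr)

variable {𝓡 π M} in
/-- `c ⊗ r` has coarse degree `0` for `r ∈ R_χ`, `χ ∈ M`. [folklore] -/
theorem tmul_mem_coarsePiece_zero {χ : G} (hχ : χ ∈ M) (c : κ) {r : R} (hr : r ∈ 𝓡 χ) :
    c ⊗ₜ[k] r ∈ coarsePiece 𝓡 M 0 := by
  rw [← (Submodule.Quotient.mk_eq_zero M).2 hχ]
  exact tmul_mem_coarsePiece c hr

/-! ## The slice -/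

variable {m : ℕ} (b : Module.Basis (Fin m) ℤ M) (u : Fin m → R)

/-- The residues `ūₗ ∈ κ` of the units. [folklore] -/
abbrev resUnit (l : Fin m) : κ := π (u l)

variable (k) in
/-- The ideal `(1 ⊗ uₗ - ūₗ ⊗ 1)ₗ` of the slice. [folklore] -/
abbrev sliceIdeal : Ideal (κ ⊗[k] R) :=
  Ideal.span (Set.range (sliceGen k u (resUnit π u)))

/-- The ideal of the slice is homogeneous (of degree `0`) for the coarse grading, the `uₗ`
having degrees in `M`. [folklore] -/
theorem isHomogeneous_sliceIdeal [DecidableEq (G ⧸ M)] (hu : ∀ l, u l ∈ 𝓡 (b l)) :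
    (sliceIdeal k π u).IsHomogeneous (coarsePiece 𝓡 M) := by
  refine Ideal.homogeneous_span _ _ ?_
  rintro _ ⟨l, rfl⟩
  refine ⟨0, Submodule.sub_mem _ (tmul_mem_coarsePiece_zero (b l).2 1 (hu l)) ?_⟩
  exact tmul_mem_coarsePiece_zero M.zero_mem _ (SetLike.one_mem_graded 𝓡)

variable (k) in
/-- **The slice** `S = (κ ⊗ₖ R) ⧸ (1 ⊗ uₗ - ūₗ ⊗ 1)ₗ`. [folklore] -/
abbrev Slice : Type := (κ ⊗[k] R) ⧸ sliceIdeal k π u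

variable (k) in
/-- **The grading of the slice** by the finite group `A = G ⧸ M`: the images of the coarse pieces
(the token hypothesis `hu` records the degrees of the units, which make the ideal homogeneous).
[folklore] -/
noncomputable def slicePiece (_hu : ∀ l, u l ∈ 𝓡 (b l)) :=
  quotGrading (coarsePiece 𝓡 M) (sliceIdeal k π u)

/-- The pieces of the slice form a grading. [folklore] -/
noncomputable instance slicePiece.gradedAlgebra [DecidableEq (G ⧸ M)] (hu : ∀ l, u l ∈ 𝓡 (b l)) :
    @GradedAlgebra (G ⧸ M) k (Slice k π u) _ _ _ _ _ (slicePiece k 𝓡 π M b u hu) :=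
  quotGrading.gradedAlgebra (coarsePiece 𝓡 M)
    ⟨sliceIdeal k π u, isHomogeneous_sliceIdeal 𝓡 π M b u hu⟩

variable (k) in
/-- The structure map `R → S`, `r ↦ (1 ⊗ r)‾`. [folklore] -/
noncomputable def toSlice : R →ₐ[k] Slice k π u :=
  (Ideal.Quotient.mkₐ k (sliceIdeal k π u)).comp Algebra.TensorProduct.includeRight

/-- Unfolding the structure map `R → S`. [folklore] -/
theorem toSlice_apply (r : R) :
    toSlice k π u r = Ideal.Quotient.mk (sliceIdeal k π u) ((1 : κ) ⊗ₜ[k] r) :=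
  rfl

/-- Homogeneous elements of `R` of degree in `M` map to degree `0` of the slice. [folklore] -/
theorem toSlice_mem_zero [DecidableEq (G ⧸ M)] (hu : ∀ l, u l ∈ 𝓡 (b l)) {χ : G} (hχ : χ ∈ M)
    {r : R} (hr : r ∈ 𝓡 χ) : toSlice k π u r ∈ slicePiece k 𝓡 π M b u hu 0 :=
  mk_mem_quotGrading (tmul_mem_coarsePiece_zero hχ 1 hr)

/-- The defining relations of the slice: `(1 ⊗ uₗ)‾ = (ūₗ ⊗ 1)‾`. [folklore] -/
theorem toSlice_unit (l : Fin m) :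
    toSlice k π u (u l) = Ideal.Quotient.mk (sliceIdeal k π u) (resUnit π u l ⊗ₜ[k] (1 : R)) := by
  rw [toSlice_apply, Ideal.Quotient.mk_eq_mk_iff_sub_mem]
  exact Ideal.subset_span ⟨l, rfl⟩

variable (k) in
/-- The structure map `R → S` through the left factor, `r ↦ (r̄ ⊗ 1)‾`. [folklore] -/
noncomputable def toSliceLeft : R →ₐ[k] Slice k π u :=
  ((Ideal.Quotient.mkₐ k (sliceIdeal k π u)).comp Algebra.TensorProduct.includeLeft).comp
    π

/-- Unfolding the structure map `R → S` through the left factor. [folklore] -/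
theorem toSliceLeft_apply (r : R) :
    toSliceLeft k π u r =
      Ideal.Quotient.mk (sliceIdeal k π u) (π r ⊗ₜ[k] (1 : R)) :=
  rfl

/-! ## The multiplicative section of homogeneous units over `M` -/

variable (hunit : ∀ l, IsUnit (u l))

/-- The units `uₗ`, as units. [folklore] -/
noncomputable def unitAt (l : Fin m) : Rˣ := (hunit l).unit

/-- **The multiplicative section** `χ ↦ u^χ := ∏ₗ uₗ ^ χₗ` (coordinates in the basis `b` of `M`)
of homogeneous units over the lattice `M`. [folklore] -/
noncomputable def unitSection (χ : M) : Rˣ := ∏ l, unitAt u hunit l ^ (b.repr χ l)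

omit [DecidableEq G] in
/-- The section is multiplicative. [folklore] -/
theorem unitSection_add (χ ψ : M) :
    unitSection M b u hunit (χ + ψ) = unitSection M b u hunit χ * unitSection M b u hunit ψ := by
  simp only [unitSection, map_add, Finsupp.add_apply, zpow_add, Finset.prod_mul_distrib]

omit [DecidableEq G] in
/-- The section at `0` is `1`. [folklore] -/
theorem unitSection_zero : unitSection M b u hunit 0 = 1 := by
  simp [unitSection]

omit [DecidableEq G] in
/-- The section on the basis is the given units. [folklore] -/
theorem coe_unitSection_basis (l : Fin m) : (unitSection M b u hunit (b l) : R) = u l := by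
  simp only [unitSection, Module.Basis.repr_self]
  rw [Finset.prod_eq_single l]
  · rw [Finsupp.single_eq_same, zpow_one]
    rfl
  · intro l' _ hl'
    rw [Finsupp.single_eq_of_ne hl', zpow_zero]
  · exact fun h => absurd (Finset.mem_univ l) h

variable {𝓡} in
/-- The inverse of a homogeneous unit is homogeneous of opposite degree. [folklore] -/
theorem val_inv_mem {U : Rˣ} {d : G} (hU : (U : R) ∈ 𝓡 d) : (↑U⁻¹ : R) ∈ 𝓡 (-d) := by
  obtain ⟨w, hw, hUw, -⟩ := exists_inv_mem_of_isUnit 𝓡 hU U.isUnit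
  rwa [Units.inv_eq_of_mul_eq_one_right hUw]

variable {𝓡} in
/-- Integer powers of a homogeneous unit are homogeneous. [folklore] -/
theorem val_zpow_mem {U : Rˣ} {d : G} (hU : (U : R) ∈ 𝓡 d) (z : ℤ) :
    (↑(U ^ z) : R) ∈ 𝓡 (z • d) := by
  cases z with
  | ofNat n =>
    rw [Int.ofNat_eq_natCast, zpow_natCast, Units.val_pow_eq_pow_val, natCast_zsmul]
    exact SetLike.pow_mem_graded n hU
  | negSucc n =>
    rw [zpow_negSucc, ← inv_pow, Units.val_pow_eq_pow_val, negSucc_zsmul, ← smul_neg]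
    exact SetLike.pow_mem_graded (n + 1) (val_inv_mem hU)

/-- The section `u^χ` is homogeneous of degree `χ`. [folklore] -/
theorem val_unitSection_mem (hu : ∀ l, u l ∈ 𝓡 (b l)) (χ : M) :
    (unitSection M b u hunit χ : R) ∈ 𝓡 (χ : G) := by
  have hdeg : ∑ l, b.repr χ l • (b l : G) = (χ : G) := by
    conv_rhs => rw [← b.sum_repr χ]
    rw [Submodule.coe_sum]
    rfl
  rw [unitSection, Units.coe_prod, ← hdeg]
  exact SetLike.prod_mem_graded 𝓡 (fun l => b.repr χ l • (b l : G)) _ fun l _ =>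
    val_zpow_mem (hu l) _

omit [DecidableEq G] in
/-- **The relations `(1 ⊗ u^χ)‾ = (ū^χ ⊗ 1)‾` in the slice** for all `χ ∈ M`: the two
structure maps `R ⇉ S` agree on the `uₗ`, hence on the subgroup of units they generate.
[folklore] -/
theorem toSlice_unitSection (χ : M) :
    toSlice k π u (unitSection M b u hunit χ) = toSliceLeft k π u (unitSection M b u hunit χ) := by
  let H : Subgroup Rˣ :=
    MonoidHom.eqLocus ((toSlice k π u : R →* Slice k π u).comp (Units.coeHom R))
    ((toSliceLeft k π u : R →* Slice k π u).comp (Units.coeHom R))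
  have hl : ∀ l, unitAt u hunit l ∈ H := fun l => toSlice_unit π u l
  exact H.prod_mem fun l _ => H.zpow_mem (hl l) _

end Setting

/-! ## Registered form -/

/-- **Registered sub-goal `stub_qs_slice`** of the crux (helper of the stub
`stub_quotientSingularities_of_regular`): the relations `(1 ⊗ u^χ)‾ = (π(u^χ) ⊗ 1)‾` hold in
the slice for every `χ` in the lattice. [folklore] -/
theorem stub_qs_slice :
    ∀ {k : Type} [Field k] {R : Type} [CommRing R] [Algebra k R] {G : Type} [AddCommGroup G]
      [DecidableEq G] {κ : Type} [CommRing κ] [Algebra k κ] (π : R →ₐ[k] κ) (M : Submodule ℤ G)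
      {m : ℕ} (b : Module.Basis (Fin m) ℤ M) (u : Fin m → R) (hunit : ∀ l, IsUnit (u l)) (χ : M),
      Summit.ResolutionOfSingularities.ResolutionOfSingularities.Theorems.DatumToEmbedded.QuotientSingularities.toSlice
          k π u
          (Summit.ResolutionOfSingularities.ResolutionOfSingularities.Theorems.DatumToEmbedded.QuotientSingularities.unitSection
            M b u hunit χ) =
        Summit.ResolutionOfSingularities.ResolutionOfSingularities.Theorems.DatumToEmbedded.QuotientSingularities.toSliceLeft
          k π u
          (Summit.ResolutionOfSingularities.ResolutionOfSingularities.Theorems.DatumToEmbedded.QuotientSingularities.unitSection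
            M b u hunit χ) :=
  fun {_} _ {_} _ _ {_} _ _ {_} _ _ π M {_} b u hunit χ => toSlice_unitSection π M b u hunit χ

end Summit.ResolutionOfSingularities.ResolutionOfSingularities.Theorems.DatumToEmbedded.QuotientSingularities
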